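import Mathlib.MeasureTheory.Measure.Portmanteau
import Mathlib.MeasureTheory.Measure.Regular
import Literature.Probability.RandomPlanarGeometry.SAWScalingLimitFamily
import Summits.CriticalPhenomena.SAWScalingLimit.Theorems.SubseqIdentification.Negative.Necessity
import Summits.CriticalPhenomena.SAWScalingLimit.Theorems.IsingBoundaryRatio.Negative.IsingBoundaryRatioNesting

/-!
# `stub_domination`: the soft half of the passage to the limit in LSW's restriction property

Stub S2 of the line `birth` for the crux `RestrictionOfLimit` (stmt-CriticalPhenomena-0773, shared verbatim
by the routes SAWConePseudogroup / SAWConfRestriction / SAWBrownianDomination / SAWTowerCount / SAWTensorRG).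

`P` is a full scaling limit of the critical `δℤ²` SAW (`SAW.IsScalingLimitFamily P`), `D' ⊆ D` are Dobrushin
domains with the same marked points, `(a_δ, b_δ)` is an endpoint approximation of `D'`, `S_δ` is the set of
SAWs of `D_δ` from `a_δ` to `b_δ` all of whose edges are edges of `D'_δ = discreteDomainGraph D'.carrier δ`,
`p_δ = P_{D,δ}(S_δ)`, `c = liminf_{δ → 0⁺} p_δ`. GIVEN the exact lattice identity S1 (the first hypothesis,
consumed verbatim) we prove DOMINATION: `c · P D'(T) ≤ P D (T ∩ R)` for Borel `T`,
`R = CurveClass.rangeSubset (closure D'.carrier)` (Lawler–Schramm–Werner, *On the scaling limit of planar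
self-avoiding walk* (2004), §3.4.5: "Hence, the limit measure … must satisfy this property").

Proof. (1) Lattice bookkeeping along `δ → 0⁺` (`eventually_lattice_bookkeeping`): eventually `a_δ ≠ b_δ`
and `meshDomain D' δ ⊆ meshDomain D δ` (the bulk of `D_δ` swallows a closed disc `K ⊆ D'`, to whose nearest
site every site of `D'_δ` is joined in the mesh graph of `D' ⊆ D`), hence `D'_δ ≤ D_δ` and `(a_δ, b_δ)` is an
endpoint approximation of `D` too. (2) Portmanteau along a filter for eventually-probability families
(`le_liminf_law_preimage_of_isOpen`, `limsup_law_preimage_le_of_isClosed`). (3) Open `U`: S1 gives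
`p_δ ν_δ(U) = μ_δ({curve ∈ U} ∩ S_δ) ≤ μ_δ(curve ∈ cl U ∩ R)` (a walk of `S_δ` between distinct endpoints has
its polyline in `cl D'`), so `c ν(U) ≤ liminf (p_δ ν_δ(U)) ≤ limsup μ_δ(cl U ∩ R) ≤ μ (cl U ∩ R)`. (4) Closed `F`
by shrinking thickenings, Borel `T` by inner regularity of `ν` (`mul_measure_le_measure_inter_of_forall_isOpen`).
Reused: `IsingBoundaryRatio.Negative.eventually_ne / discreteDomainGraph_mono / isEndpointApprox_of_subdomain`,
`SubseqIdentification.Negative.walk_range_toCurve_subset / isProbabilityMeasure_law_or_eq_zero`.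
No named fact is used; axioms `propext`, `Classical.choice`, `Quot.sound`.
-/

noncomputable section

open MeasureTheory Filter Topology Set Metric Literature.Probability.RandomPlanarGeometry
  Literature.Probability.LatticeModels
open scoped ENNReal NNReal BoundedContinuousFunction

namespace Summit.CriticalPhenomena.SAWScalingLimit.Theorems.RestrictionOfLimit.Birth

/-! ### 1. Portmanteau along a filter for eventually-probability families -/

section Portmanteau

variable {ι X : Type*} {L : Filter ι} [MeasurableSpace X] [TopologicalSpace X]
  [OpensMeasurableSpace X]

/-- A family of measures which are EVENTUALLY probability measures and whose integrals of bounded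
continuous functions converge to those of a probability measure `μ` is eventually equal to a family of
`ProbabilityMeasure`s converging to `μ` (`ProbabilityMeasure.tendsto_iff_forall_integral_tendsto`). [folklore] -/
theorem exists_probabilityMeasure_tendsto_of_forall_integral_tendsto {μ : Measure X}
    [hμ : IsProbabilityMeasure μ] {ms : ι → Measure X}
    (hprob : ∀ᶠ i in L, IsProbabilityMeasure (ms i))
    (hlim : ∀ f : X →ᵇ ℝ, Tendsto (fun i => ∫ x, f x ∂(ms i)) L (𝓝 (∫ x, f x ∂μ))) :
    ∃ PM : ι → ProbabilityMeasure X, (∀ᶠ i in L, (PM i : Measure X) = ms i) ∧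
      Tendsto PM L (𝓝 ⟨μ, hμ⟩) := by
  have key : ∀ i, ∃ Q : ProbabilityMeasure X,
      IsProbabilityMeasure (ms i) → (Q : Measure X) = ms i := fun i => by
    by_cases h : IsProbabilityMeasure (ms i)
    exacts [⟨⟨ms i, h⟩, fun _ => rfl⟩, ⟨⟨μ, hμ⟩, fun h' => absurd h' h⟩]
  choose PM hPM using key
  have heq : ∀ᶠ i in L, (PM i : Measure X) = ms i := hprob.mono hPM
  refine ⟨PM, heq, ProbabilityMeasure.tendsto_iff_forall_integral_tendsto.2 fun f => ?_⟩
  refine (hlim f).congr' (heq.mono fun i hi => ?_)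
  show ∫ x, f x ∂(ms i) = ∫ x, f x ∂(PM i : Measure X)
  rw [hi]

/-- **Portmanteau, closed sets, along a filter**: if `ms i` are eventually probability measures with
`∫ f d(ms i) → ∫ f dμ` for bounded continuous `f` (`μ` a probability measure), then `limsup (ms i F) ≤ μ F`
for closed `F`. [folklore] -/
theorem limsup_measure_closed_le_of_forall_integral_tendsto [HasOuterApproxClosed X] {μ : Measure X}
    [hμ : IsProbabilityMeasure μ] {ms : ι → Measure X}
    (hprob : ∀ᶠ i in L, IsProbabilityMeasure (ms i))
    (hlim : ∀ f : X →ᵇ ℝ, Tendsto (fun i => ∫ x, f x ∂(ms i)) L (𝓝 (∫ x, f x ∂μ)))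
    {F : Set X} (hF : IsClosed F) : limsup (fun i => ms i F) L ≤ μ F := by
  obtain ⟨PM, heq, hT⟩ := exists_probabilityMeasure_tendsto_of_forall_integral_tendsto hprob hlim
  calc limsup (fun i => ms i F) L = limsup (fun i => (PM i : Measure X) F) L :=
        limsup_congr (heq.mono fun i hi => by rw [hi])
    _ ≤ μ F := ProbabilityMeasure.limsup_measure_closed_le_of_tendsto hT hF

/-- **Portmanteau, open sets, along a filter**: if `ms i` are eventually probability measures with
`∫ f d(ms i) → ∫ f dμ` for bounded continuous `f` (`μ` a probability measure), then `μ U ≤ liminf (ms i U)`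
for open `U`. [folklore] -/
theorem le_liminf_measure_open_of_forall_integral_tendsto [HasOuterApproxClosed X] {μ : Measure X}
    [hμ : IsProbabilityMeasure μ] {ms : ι → Measure X}
    (hprob : ∀ᶠ i in L, IsProbabilityMeasure (ms i))
    (hlim : ∀ f : X →ᵇ ℝ, Tendsto (fun i => ∫ x, f x ∂(ms i)) L (𝓝 (∫ x, f x ∂μ)))
    {U : Set X} (hU : IsOpen U) : μ U ≤ liminf (fun i => ms i U) L := by
  obtain ⟨PM, heq, hT⟩ := exists_probabilityMeasure_tendsto_of_forall_integral_tendsto hprob hlim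
  calc μ U ≤ liminf (fun i => (PM i : Measure X) U) L :=
        ProbabilityMeasure.le_liminf_measure_open_of_tendsto hT hU
    _ = liminf (fun i => ms i U) L := liminf_congr (heq.mono fun i hi => by rw [hi])

end Portmanteau

/-! ### 2. From open sets to Borel sets: thickenings and inner regularity -/

section Regular

variable {X : Type*} [PseudoMetricSpace X] [MeasurableSpace X] [BorelSpace X]

/-- **From open sets to all Borel sets.** For finite Borel measures `μ`, `ν` on a (pseudo)metric space,
`c : ℝ≥0∞` and any set `R`: if `c · ν U ≤ μ (closure U ∩ R)` for every open `U`, then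
`c · ν T ≤ μ (T ∩ R)` for every Borel `T` — closed `F` through the open `ε`-thickenings and
`μ|_R (cthickening ε F) → μ|_R (F)` (`ε → 0⁺`), Borel `T` by inner regularity of `ν`. [folklore] -/
theorem mul_measure_le_measure_inter_of_forall_isOpen {μ ν : Measure X} [IsFiniteMeasure μ]
    [IsFiniteMeasure ν] {c : ℝ≥0∞} {R : Set X}
    (h : ∀ U : Set X, IsOpen U → c * ν U ≤ μ (closure U ∩ R)) {T : Set X}
    (hT : MeasurableSet T) : c * ν T ≤ μ (T ∩ R) := by
  -- closed sets, through the open thickenings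
  have hclosed : ∀ F : Set X, IsClosed F → c * ν F ≤ μ (F ∩ R) := by
    intro F hF
    have key : ∀ ε : ℝ, 0 < ε → c * ν F ≤ μ.restrict R (cthickening ε F) := by
      intro ε hε
      rw [Measure.restrict_apply isClosed_cthickening.measurableSet]
      calc c * ν F ≤ c * ν (thickening ε F) :=
            mul_le_mul' le_rfl (measure_mono (self_subset_thickening hε F))
        _ ≤ μ (closure (thickening ε F) ∩ R) := h _ isOpen_thickening
        _ ≤ μ (cthickening ε F ∩ R) :=
            measure_mono (inter_subset_inter_left _ (closure_thickening_subset_cthickening ε F))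
    have hlim : Tendsto (fun ε : ℝ => μ.restrict R (cthickening ε F)) (𝓝[>] 0)
        (𝓝 (μ.restrict R F)) :=
      (tendsto_measure_cthickening_of_isClosed ⟨1, one_pos, measure_ne_top _ _⟩ hF).mono_left
        nhdsWithin_le_nhds
    have hle := ge_of_tendsto hlim (eventually_nhdsWithin_of_forall fun ε hε => key ε hε)
    rwa [Measure.restrict_apply hF.measurableSet] at hle
  -- Borel sets, by inner regularity of the finite Borel measure `ν`
  rw [hT.measure_eq_iSup_isClosed_of_ne_top (measure_ne_top ν T)]
  simp only [ENNReal.mul_iSup]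
  exact iSup_le fun F => iSup_le fun hFT => iSup_le fun hF =>
    (hclosed F hF).trans (measure_mono (inter_subset_inter_left _ hFT))

end Regular

/-! ### 3. Lattice bookkeeping along `δ → 0⁺` -/

/-- **Inner inclusion of the discrete domains of nested Dobrushin domains**: if `D'.carrier ⊆ D.carrier`
then eventually `meshDomain D' δ ⊆ meshDomain D δ` (no endpoint approximation needed, unlike
`IsingBoundaryRatio.Negative.eventually_meshDomain_subset`). A closed disc `K ⊆ D'` is swallowed by the bulks
of both `D'_δ` and `D_δ` (`JordanDomain.eventually_forall_mem_meshDomain'`); every site of `D'_δ` is joined to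
the site nearest to its centre in the mesh graph on the mesh vertices of `D' ⊆ D`, so lies in the bulk of `D_δ`.
[folklore] -/
theorem eventually_meshDomain_subset {D D' : DobrushinDomain} (hsub : D'.carrier ⊆ D.carrier) :
    ∀ᶠ δ in 𝓝[>] (0 : ℝ), meshDomain D'.carrier δ ⊆ meshDomain D.carrier δ := by
  -- adapted from `IsingBoundaryRatio.Negative.isEndpointApprox_of_subdomain`
  obtain ⟨z, hz⟩ := D'.nonempty
  obtain ⟨r, hr, hball⟩ := Metric.isOpen_iff.1 D'.isOpen z hz
  have hK' : closedBall z (r / 2) ⊆ D'.carrier := (closedBall_subset_ball (by linarith)).trans hball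
  filter_upwards [D'.toJordanDomain.eventually_forall_mem_meshDomain' (isCompact_closedBall z (r / 2))
      hK', D.toJordanDomain.eventually_forall_mem_meshDomain' (isCompact_closedBall z (r / 2))
      (hK'.trans hsub), Ioo_mem_nhdsGT (half_pos hr)] with δ h' h hδ
  have hyK : meshPoint δ (nearestSite δ z) ∈ closedBall z (r / 2) :=
    mem_closedBall.2 ((dist_meshPoint_nearestSite_le hδ.1 z).trans hδ.2.le)
  intro x hx
  obtain ⟨hyv, hxv, hreach⟩ := h'.2 _ (h'.1 _ hyK) x hx
  have hreachD := hreach.map (IsingBoundaryRatio.Negative.meshVertexHom hsub δ)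
  exact IsingBoundaryRatio.Negative.mem_meshDomain_of_reachable_vertex
    (x := ⟨_, IsingBoundaryRatio.Negative.meshVertices_mono hsub δ hyv⟩) (h.1 _ hyK) hreachD

/-- **Eventually `D'_δ ≤ D_δ`** for nested Dobrushin domains `D'.carrier ⊆ D.carrier`. [folklore] -/
theorem eventually_discreteDomainGraph_le {D D' : DobrushinDomain} (hsub : D'.carrier ⊆ D.carrier) :
    ∀ᶠ δ in 𝓝[>] (0 : ℝ), discreteDomainGraph D'.carrier δ ≤ discreteDomainGraph D.carrier δ :=
  (eventually_meshDomain_subset hsub).mono fun _ h =>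
    IsingBoundaryRatio.Negative.discreteDomainGraph_mono hsub h

/-- **The lattice bookkeeping of the line, bundled**: for Dobrushin `D' ⊆ D` and an endpoint approximation
`(a_δ, b_δ)` of `D'`, eventually: `0 < δ`, `a_δ ≠ b_δ` joined in `D'_δ`, `meshDomain D' δ ⊆ meshDomain D δ`,
`D'_δ ≤ D_δ` (and `(a_δ, b_δ)` is an endpoint approximation of `D` with the same marked points:
`IsingBoundaryRatio.Negative.isEndpointApprox_of_subdomain`). [folklore] -/
theorem eventually_lattice_bookkeeping {D D' : DobrushinDomain} (hsub : D'.carrier ⊆ D.carrier)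
    {a b : ℝ → Site 2} (hab : SAW.IsEndpointApprox D' a b) :
    ∀ᶠ δ in 𝓝[>] (0 : ℝ), 0 < δ ∧ a δ ≠ b δ ∧
      (discreteDomainGraph D'.carrier δ).Reachable (a δ) (b δ) ∧
      meshDomain D'.carrier δ ⊆ meshDomain D.carrier δ ∧
      discreteDomainGraph D'.carrier δ ≤ discreteDomainGraph D.carrier δ := by
  filter_upwards [self_mem_nhdsWithin, IsingBoundaryRatio.Negative.eventually_ne hab, hab.reachable,
    eventually_meshDomain_subset hsub] with δ hδ hne hr hD
  exact ⟨hδ, hne, hr, hD, IsingBoundaryRatio.Negative.discreteDomainGraph_mono hsub hD⟩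

/-- The trace of the polyline of a walk between DISTINCT vertices lies in any set containing the closed
segment of every dart (the base vertex is the first endpoint of the first dart). [folklore] -/
theorem range_toCurve_subset_of_ne {V E : Type*} [AddCommGroup E] [Module ℝ E] [TopologicalSpace E]
    [ContinuousAdd E] [ContinuousSMul ℝ E] {G : SimpleGraph V} {S : Set E} {emb : V → E}
    {u v : V} (huv : u ≠ v) (p : G.Walk u v)
    (hd : ∀ d ∈ p.darts, segment ℝ (emb d.fst) (emb d.snd) ⊆ S) :
    Set.range (p.toCurve emb) ⊆ S := by
  cases p with
  | nil => exact absurd rfl huv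
  | cons h q =>
    refine SubseqIdentification.Negative.walk_range_toCurve_subset _ ?_ hd
    rw [SimpleGraph.Walk.darts_cons] at hd
    exact hd _ List.mem_cons_self (left_mem_segment ℝ _ _)

/-- **A SAW of `Ω_δ` all of whose edges are edges of `Ω'_δ`, between distinct endpoints, has its
polyline in `closure Ω'`**: every edge of `Ω'_δ` is a closed segment of `closure Ω'`. [folklore] -/
theorem range_curve_subset_closure_of_edges {Ω Ω' : Set ℂ} {δ : ℝ} {a b : Site 2} (hab : a ≠ b)
    (γ : SAW.DomainSAW Ω δ a b)
    (hγ : ∀ e ∈ γ.walk.edges, e ∈ (discreteDomainGraph Ω' δ).edgeSet) :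
    γ.curve.range ⊆ closure Ω' := by
  have hd : ∀ d ∈ γ.walk.darts,
      segment ℝ (meshPoint δ d.fst) (meshPoint δ d.snd) ⊆ closure Ω' := by
    intro d hd
    have he : s(d.fst, d.snd) ∈ (discreteDomainGraph Ω' δ).edgeSet :=
      hγ d.edge (List.mem_map.2 ⟨d, hd, rfl⟩)
    exact (meshGraph_adj_iff.1 (discreteDomainGraph_le_meshGraph Ω' δ
      ((SimpleGraph.mem_edgeSet _).1 he))).2
  rintro _ ⟨t, rfl⟩
  exact range_toCurve_subset_of_ne hab γ.walk hd ⟨t, rfl⟩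

/-! ### 4. Weak convergence of the SAW laws (portmanteau in `SAW.law` terms), then the stub -/

variable {P : ChordalFamily}

/-- **The SAW laws of a scaling-limit family are eventually probability measures** along every endpoint
approximation: their mass is `0` or `1` and the test integral of `f ≡ 1` tends to `1`. [folklore] -/
theorem eventually_isProbabilityMeasure_law (hP : SAW.IsScalingLimitFamily P) {D : DobrushinDomain}
    {a b : ℝ → Site 2} (hab : SAW.IsEndpointApprox D a b) :
    ∀ᶠ δ in 𝓝[>] (0 : ℝ), IsProbabilityMeasure (SAW.law D.carrier δ (a δ) (b δ)) := by
  -- adapted from `SubseqIdentification.Negative.eventually_isProbabilityMeasure_of_tendsto`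
  haveI := hP.isProbabilityMeasure D
  have hlim : Tendsto (fun δ => (SAW.law D.carrier δ (a δ) (b δ)).real univ) (𝓝[>] (0 : ℝ))
      (𝓝 1) := by
    have h := hP.tendstoLaw hab 1
    simpa only [BoundedContinuousFunction.coe_one, Pi.one_apply, integral_const, smul_eq_mul,
      mul_one, probReal_univ] using h
  filter_upwards [hlim.eventually (lt_mem_nhds (show (1 : ℝ) / 2 < 1 by norm_num))] with δ hδ
  rcases SubseqIdentification.Negative.isProbabilityMeasure_law_or_eq_zero D.carrier δ (a δ) (b δ)
    with h | h
  · exact h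
  · exfalso
    rw [h, measureReal_zero, Pi.zero_apply] at hδ
    linarith

/-- The test integrals against the PUSHED law `(P_{D,δ}) ∘ curve⁻¹` converge to those of `P D`. [folklore] -/
theorem tendsto_integral_map_curve (hP : SAW.IsScalingLimitFamily P) {D : DobrushinDomain}
    {a b : ℝ → Site 2} (hab : SAW.IsEndpointApprox D a b) (f : CurveClass ℂ →ᵇ ℝ) :
    Tendsto (fun δ => ∫ x, f x ∂((SAW.law D.carrier δ (a δ) (b δ)).map
      (fun γ : SAW.DomainSAW D.carrier δ (a δ) (b δ) => γ.curve))) (𝓝[>] (0 : ℝ))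
      (𝓝 (∫ x, f x ∂(P D))) := by
  refine (hP.tendstoLaw hab f).congr fun δ => ?_
  show ∫ γ, f γ.curve ∂(SAW.law D.carrier δ (a δ) (b δ)) =
    ∫ x, f x ∂((SAW.law D.carrier δ (a δ) (b δ)).map (fun γ => γ.curve))
  exact (integral_map (SAW.DomainSAW.measurable_of_top _).aemeasurable
    f.continuous.aestronglyMeasurable).symm

/-- The pushed SAW laws of a scaling-limit family are eventually probability measures. [folklore] -/
theorem eventually_isProbabilityMeasure_map_curve (hP : SAW.IsScalingLimitFamily P)
    {D : DobrushinDomain} {a b : ℝ → Site 2} (hab : SAW.IsEndpointApprox D a b) :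
    ∀ᶠ δ in 𝓝[>] (0 : ℝ), IsProbabilityMeasure ((SAW.law D.carrier δ (a δ) (b δ)).map
      (fun γ : SAW.DomainSAW D.carrier δ (a δ) (b δ) => γ.curve)) :=
  (eventually_isProbabilityMeasure_law hP hab).mono fun δ hδ => by
    haveI := hδ
    exact Measure.isProbabilityMeasure_map (SAW.DomainSAW.measurable_of_top _).aemeasurable

/-- **Portmanteau for the SAW scaling limit, closed sets (PC)**: for a scaling-limit family `P`, every
Dobrushin `D`, endpoint approximation `(a_δ, b_δ)`, closed `C`: `limsup_{δ→0⁺} P_{D,δ}(curve ∈ C) ≤ P D (C)`. [folklore] -/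
theorem limsup_law_preimage_le_of_isClosed (hP : SAW.IsScalingLimitFamily P) {D : DobrushinDomain}
    {a b : ℝ → Site 2} (hab : SAW.IsEndpointApprox D a b) {C : Set (CurveClass ℂ)}
    (hC : IsClosed C) :
    limsup (fun δ => SAW.law D.carrier δ (a δ) (b δ)
      ((fun γ : SAW.DomainSAW D.carrier δ (a δ) (b δ) => γ.curve) ⁻¹' C)) (𝓝[>] (0 : ℝ)) ≤
      P D C := by
  haveI := hP.isProbabilityMeasure D
  have h := limsup_measure_closed_le_of_forall_integral_tendsto
    (eventually_isProbabilityMeasure_map_curve hP hab) (tendsto_integral_map_curve hP hab) hC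
  refine (limsup_congr (Eventually.of_forall fun δ => ?_)).trans_le h
  exact (Measure.map_apply (SAW.DomainSAW.measurable_of_top _) hC.measurableSet).symm

/-- **Portmanteau for the SAW scaling limit, open sets (PO)**: for a scaling-limit family `P`, every
Dobrushin `D`, endpoint approximation `(a_δ, b_δ)`, open `U`: `P D (U) ≤ liminf_{δ→0⁺} P_{D,δ}(curve ∈ U)`. [folklore] -/
theorem le_liminf_law_preimage_of_isOpen (hP : SAW.IsScalingLimitFamily P) {D : DobrushinDomain}
    {a b : ℝ → Site 2} (hab : SAW.IsEndpointApprox D a b) {U : Set (CurveClass ℂ)}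
    (hU : IsOpen U) :
    P D U ≤ liminf (fun δ => SAW.law D.carrier δ (a δ) (b δ)
      ((fun γ : SAW.DomainSAW D.carrier δ (a δ) (b δ) => γ.curve) ⁻¹' U)) (𝓝[>] (0 : ℝ)) := by
  haveI := hP.isProbabilityMeasure D
  have h := le_liminf_measure_open_of_forall_integral_tendsto
    (eventually_isProbabilityMeasure_map_curve hP hab) (tendsto_integral_map_curve hP hab) hU
  refine h.trans_eq (liminf_congr (Eventually.of_forall fun δ => ?_))
  exact Measure.map_apply (SAW.DomainSAW.measurable_of_top _) hU.measurableSet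

/-- **S2 — domination, the soft half of the passage to the limit** (Lawler–Schramm–Werner 2004, §3.4.5:
"Hence, the limit measure … must satisfy this property"). Given the exact lattice identity (the
hypothesis: S1 verbatim), for every full scaling-limit family `P` of the critical `δℤ²` SAW, all Dobrushin
`D' ⊆ D` with the same marked points, every endpoint approximation `(a_δ, b_δ)` of `D'` and every Borel
`T`: `c · P D' (T) ≤ P D (T ∩ {γ ⊆ cl D'})` with `c = liminf_{δ→0⁺} P_{D,δ}[the walk is a walk of D'_δ]`.
Proof: for open `U`, eventually `p_δ · P_{D',δ}(curve ∈ U) = P_{D,δ}({curve ∈ U} ∩ S_δ) ≤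
P_{D,δ}(curve ∈ cl U ∩ R)` (S1 with `D'_δ ≤ D_δ`; a walk of `S_δ` between distinct endpoints has its polyline
in `cl D'`), so `c ν(U) ≤ liminf (p_δ ν_δ(U)) ≤ limsup μ_δ(cl U ∩ R) ≤ μ (cl U ∩ R)` by (PO) for `ν_δ ⇒ P D'` and
(PC) for `μ_δ ⇒ P D`; then closed sets by shrinking thickenings and Borel sets by inner regularity of `P D'`
(`mul_measure_le_measure_inter_of_forall_isOpen`). Nothing SAW-specific beyond the hypothesis. [folklore] -/
theorem stub_domination :
    (∀ (Ω Ω' : Set ℂ) (δ : ℝ) (a b : Site 2),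
      discreteDomainGraph Ω' δ ≤ discreteDomainGraph Ω δ →
        ∀ T : Set (CurveClass ℂ),
          SAW.law Ω' δ a b ((fun γ : SAW.DomainSAW Ω' δ a b => γ.curve) ⁻¹' T) *
              SAW.law Ω δ a b
                {γ : SAW.DomainSAW Ω δ a b | ∀ e ∈ γ.walk.edges, e ∈ (discreteDomainGraph Ω' δ).edgeSet} =
            SAW.law Ω δ a b
              (((fun γ : SAW.DomainSAW Ω δ a b => γ.curve) ⁻¹' T) ∩
                {γ : SAW.DomainSAW Ω δ a b |
                  ∀ e ∈ γ.walk.edges, e ∈ (discreteDomainGraph Ω' δ).edgeSet})) →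
    ∀ P : ChordalFamily, SAW.IsScalingLimitFamily P →
      ∀ (D D' : DobrushinDomain), D'.carrier ⊆ D.carrier → D'.pt 0 = D.pt 0 → D'.pt 1 = D.pt 1 →
        ∀ (a b : ℝ → Site 2), SAW.IsEndpointApprox D' a b →
          ∀ T : Set (CurveClass ℂ), MeasurableSet T →
            Filter.liminf (fun δ : ℝ => SAW.law D.carrier δ (a δ) (b δ)
                {γ : SAW.DomainSAW D.carrier δ (a δ) (b δ) |
                  ∀ e ∈ γ.walk.edges, e ∈ (discreteDomainGraph D'.carrier δ).edgeSet})
              (𝓝[>] (0 : ℝ)) * P D' T ≤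
            P D (T ∩ CurveClass.rangeSubset (closure D'.carrier)) := by
  intro hL P hP D D' hsub h0 h1 a b hab T hT
  haveI := hP.isProbabilityMeasure D
  haveI := hP.isProbabilityMeasure D'
  have habD : SAW.IsEndpointApprox D a b :=
    IsingBoundaryRatio.Negative.isEndpointApprox_of_subdomain hab hsub h0 h1
  have hR : IsClosed (CurveClass.rangeSubset (closure D'.carrier) : Set (CurveClass ℂ)) :=
    CurveClass.isClosed_rangeSubset isClosed_closure
  refine mul_measure_le_measure_inter_of_forall_isOpen (fun U hU => ?_) hT
  -- the lattice step, eventually in `δ`: `p_δ · ν_δ(U) ≤ μ_δ(curve ∈ closure U ∩ R)`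
  have h5 : ∀ᶠ δ in 𝓝[>] (0 : ℝ),
      SAW.law D.carrier δ (a δ) (b δ) {γ : SAW.DomainSAW D.carrier δ (a δ) (b δ) |
          ∀ e ∈ γ.walk.edges, e ∈ (discreteDomainGraph D'.carrier δ).edgeSet} *
        SAW.law D'.carrier δ (a δ) (b δ) ((fun γ : SAW.DomainSAW D'.carrier δ (a δ) (b δ) => γ.curve) ⁻¹' U) ≤
      SAW.law D.carrier δ (a δ) (b δ) ((fun γ : SAW.DomainSAW D.carrier δ (a δ) (b δ) => γ.curve) ⁻¹'
        (closure U ∩ CurveClass.rangeSubset (closure D'.carrier))) := by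
    filter_upwards [IsingBoundaryRatio.Negative.eventually_ne hab, eventually_discreteDomainGraph_le hsub]
      with δ hne hle
    rw [mul_comm, hL D.carrier D'.carrier δ (a δ) (b δ) hle U]
    refine measure_mono ?_
    rintro ω ⟨hωU, hωS⟩
    exact ⟨subset_closure hωU, range_curve_subset_closure_of_edges hne ω hωS⟩
  calc _ ≤ Filter.liminf ((fun δ : ℝ => SAW.law D.carrier δ (a δ) (b δ) {γ : SAW.DomainSAW D.carrier δ (a δ) (b δ) |
            ∀ e ∈ γ.walk.edges, e ∈ (discreteDomainGraph D'.carrier δ).edgeSet}) *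
        fun δ : ℝ => SAW.law D'.carrier δ (a δ) (b δ)
          ((fun γ : SAW.DomainSAW D'.carrier δ (a δ) (b δ) => γ.curve) ⁻¹' U)) (𝓝[>] (0 : ℝ)) :=
        (mul_le_mul' le_rfl (le_liminf_law_preimage_of_isOpen hP hab hU)).trans ENNReal.le_liminf_mul
    _ ≤ Filter.liminf (fun δ : ℝ => SAW.law D.carrier δ (a δ) (b δ)
          ((fun γ : SAW.DomainSAW D.carrier δ (a δ) (b δ) => γ.curve) ⁻¹'
            (closure U ∩ CurveClass.rangeSubset (closure D'.carrier)))) (𝓝[>] (0 : ℝ)) :=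
        liminf_le_liminf h5
    _ ≤ P D (closure U ∩ CurveClass.rangeSubset (closure D'.carrier)) :=
        le_trans liminf_le_limsup (limsup_law_preimage_le_of_isClosed hP habD (isClosed_closure.inter hR))

end Summit.CriticalPhenomena.SAWScalingLimit.Theorems.RestrictionOfLimit.Birth

end
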